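import Literature.Topology.FourManifolds.SPC4HandlesNormalFormProofs
import Literature.Topology.FourManifolds.HCobordismLevelDeformationProof
import HarnessLib

/-!
# Normalising a handle decomposition with several `0`-handles: explicit counts

Topic `Literature/Topology/FourManifolds`; a bookkeeping complement to `SPC4HandlesNormalForm.lean`
(NORM: *a compact connected `(n+1)`-manifold with boundary carrying an adapted Morse function with
critical points of index `≤ 1` has one with a single critical point of index `0`*), written for the
fact seat of `Literature.Topology.FourManifolds.Trisection.isConnectedSum_of_reducing_separating`
(`ReducibleTrisectionSplitting.lean`, § Status, road (P1′)), where sublevel bodies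
`{q(x, y) + z² + w² ≤ c} ⊂ ℝ⁴` of planar Morse functions with **several** minima occur (the core
`Z₀` of a cut `1`-handlebody, the cut pieces) and their `1`-handle number must be known exactly.

The tree's cancellation step
`Literature.Topology.FourManifolds.exists_isMorseAdapted_ncard_criticalSetOfIndex_zero_add_one_eq n`
(Juhász (2023), proof of Thm. 2.7, Step 1; Milnor (1965), Thm. 5.4 as in the proof of Thm. 8.1,
Index 0) removes one critical point of index `0` **and one of index `1`** and keeps all other
counts; it is a theorem for every `n`
(`exists_isMorseAdapted_ncard_criticalSetOfIndex_zero_add_one_eq_of_levelDeformation` with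
`Cobordism.Milnor1965_cancellation_levelDeformation_holds`).  The induction of
`exists_isMorseAdapted_ncard_zero_eq_one_of_cancel` (`SPC4HandlesNormalForm.lean`) forgets the
index-`1` count; here it is kept:

* `exists_isMorseAdapted_ncard_eq_of_counts`: on a compact connected `(n+1)`-manifold with
  boundary, an adapted Morse function with `r + 1` critical points of index `0` and `s + r` of
  index `1` can be replaced by one with `1` of index `0`, `s` of index `1`, and the same number of
  critical points of every index `≥ 2`;
* `hasHandleDecomposition_of_counts`: `HasHandleDecomposition n W c` with `c 0 = r + 1`,
  `c 1 = s + r` gives `HasHandleDecomposition n W c'` with `c' 0 = 1`, `c' 1 = s`, `c' k = c k`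
  (`k ≥ 2`);
* `hasHandleDecomposition_handleCount_one_of_counts`: in particular `m` `0`-handles, `s + (m - 1)`
  `1`-handles and nothing else normalise to `handleCount 1 s` — the Euler-characteristic count
  `#(1-handles) - #(0-handles) + 1` of the `1`-handle number of a connected `1`-handlebody.

Everything is **proved**; no definition, no named fact.

## References
* A. Juhász, *Differential and Low-Dimensional Topology*, LMS Student Texts 104 (2023), proof of
  Thm. 2.7, Step 1; §6.1. [Juhasz2023]
* J. Milnor, *Lectures on the h-cobordism theorem* (1965), Thm. 5.4; proof of Thm. 8.1, Index 0.
  [MilnorHCobordism1965]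
* Y. Matsumoto, *An introduction to Morse theory* (2002), proof of Thm. 3.35 (pp. 119–120).
  [Matsumoto2001]
-/

open scoped Manifold ContDiff Topology
open Set Function

noncomputable section

namespace Literature.Topology.FourManifolds

universe u

variable {n : ℕ}

/-- **Cancelling all superfluous `0`-handles, with the `1`-handle count kept**: on a compact
connected `(n+1)`-manifold with boundary, an adapted Morse function with `r + 1` critical points
of index `0` and `s + r` of index `1` is replaced by one with exactly one critical point of index
`0`, `s` of index `1`, and as many of each index `≥ 2` (Matsumoto (2002), p. 120: "Repeating this
argument, we obtain a Morse function `g` with only one critical point of index `0`"; each step is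
Juhász (2023), proof of Thm. 2.7, Step 1). [cite: Juhasz2023, proof of Thm. 2.7, Step 1] -/
theorem exists_isMorseAdapted_ncard_eq_of_counts
    (W : Type u) [TopologicalSpace W] [T2Space W] [SecondCountableTopology W] [CompactSpace W]
    [ConnectedSpace W] [ChartedSpace (EuclideanHalfSpace (n + 1)) W] [IsManifold (𝓡∂ (n + 1)) ∞ W] :
    ∀ (r s : ℕ) (f : W → ℝ), IsMorseAdapted (𝓡∂ (n + 1)) f →
      (criticalSetOfIndex (𝓡∂ (n + 1)) f 0).ncard = r + 1 →
      (criticalSetOfIndex (𝓡∂ (n + 1)) f 1).ncard = s + r →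
      ∃ g : W → ℝ, IsMorseAdapted (𝓡∂ (n + 1)) g ∧
        (criticalSetOfIndex (𝓡∂ (n + 1)) g 0).ncard = 1 ∧
        (criticalSetOfIndex (𝓡∂ (n + 1)) g 1).ncard = s ∧
        ∀ k, 2 ≤ k → (criticalSetOfIndex (𝓡∂ (n + 1)) g k).ncard =
          (criticalSetOfIndex (𝓡∂ (n + 1)) f k).ncard := by
  have hK := exists_isMorseAdapted_ncard_criticalSetOfIndex_zero_add_one_eq_of_levelDeformation
    Cobordism.Milnor1965_cancellation_levelDeformation_holds.{u} n
  intro r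
  induction r with
  | zero =>
    intro s f hf h0 h1
    exact ⟨f, hf, h0, by simpa using h1, fun k _ => rfl⟩
  | succ r ih =>
    intro s f hf h0 h1
    obtain ⟨g₁, hg₁, h0₁, h1₁, hk₁⟩ := hK W f hf (by omega)
    obtain ⟨g, hg, h0g, h1g, hkg⟩ := ih s g₁ hg₁ (by omega) (by omega)
    exact ⟨g, hg, h0g, h1g, fun k hk => (hkg k hk).trans (hk₁ k hk)⟩

/-- **Normalising the handle counts**: a handle decomposition of a compact connected
`(n+1)`-manifold with boundary with `r + 1` handles of index `0` and `s + r` of index `1` can be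
traded for one with a single `0`-handle, `s` `1`-handles and the same number of handles of every
index `≥ 2`. [cite: Juhasz2023, proof of Thm. 2.7, Step 1] -/
theorem hasHandleDecomposition_of_counts
    {W : Type u} [TopologicalSpace W] [T2Space W] [SecondCountableTopology W] [CompactSpace W]
    [ConnectedSpace W] [ChartedSpace (EuclideanHalfSpace (n + 1)) W] [IsManifold (𝓡∂ (n + 1)) ∞ W]
    {c : ℕ → ℕ} {r s : ℕ} (h : HasHandleDecomposition n W c) (h0 : c 0 = r + 1) (h1 : c 1 = s + r) :
    HasHandleDecomposition n W fun k => if k = 0 then 1 else if k = 1 then s else c k := by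
  obtain ⟨f, hf, hc⟩ := h
  obtain ⟨g, hg, hg0, hg1, hgk⟩ := exists_isMorseAdapted_ncard_eq_of_counts W r s f hf
    ((hc 0).trans h0) ((hc 1).trans h1)
  refine ⟨g, hg, fun k => ?_⟩
  rcases Nat.lt_or_ge k 2 with hk | hk
  · interval_cases k
    · simpa using hg0
    · simpa using hg1
  · show _ = (if k = 0 then 1 else if k = 1 then s else c k)
    rw [if_neg (by omega), if_neg (by omega), hgk k hk, hc k]

/-- **The `1`-handle number of a connected `1`-handlebody**: `m` `0`-handles (`m ≥ 1`),
`s + (m - 1)` `1`-handles and no handle of index `≥ 2` normalise to one `0`-handle and `s`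
`1`-handles (`handleCount 1 s`). [cite: Juhasz2023, §6.1 and proof of Thm. 2.7, Step 1] -/
theorem hasHandleDecomposition_handleCount_one_of_counts
    {W : Type u} [TopologicalSpace W] [T2Space W] [SecondCountableTopology W] [CompactSpace W]
    [ConnectedSpace W] [ChartedSpace (EuclideanHalfSpace (n + 1)) W] [IsManifold (𝓡∂ (n + 1)) ∞ W]
    {c : ℕ → ℕ} {r s : ℕ} (h : HasHandleDecomposition n W c) (h0 : c 0 = r + 1) (h1 : c 1 = s + r)
    (h2 : ∀ k, 2 ≤ k → c k = 0) : HasHandleDecomposition n W (handleCount 1 s) := by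
  have h' := hasHandleDecomposition_of_counts h h0 h1
  have e : (fun k => if k = 0 then 1 else if k = 1 then s else c k) = handleCount 1 s := by
    funext k
    rcases Nat.lt_or_ge k 2 with hk | hk
    · interval_cases k
      · simp
      · simp
    · rw [if_neg (by omega), if_neg (by omega), handleCount_of_two_le _ _ hk, h2 k hk]
  rw [e] at h'
  exact h'

/-- The same with the counts packaged as `handleCount m (s + (m - 1))`, `1 ≤ m`.
[cite: Juhasz2023, §6.1 and proof of Thm. 2.7, Step 1] -/
theorem hasHandleDecomposition_handleCount_one_of_handleCount
    {W : Type u} [TopologicalSpace W] [T2Space W] [SecondCountableTopology W] [CompactSpace W]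
    [ConnectedSpace W] [ChartedSpace (EuclideanHalfSpace (n + 1)) W] [IsManifold (𝓡∂ (n + 1)) ∞ W]
    {m s : ℕ} (hm : 1 ≤ m) (h : HasHandleDecomposition n W (handleCount m (s + (m - 1)))) :
    HasHandleDecomposition n W (handleCount 1 s) :=
  hasHandleDecomposition_handleCount_one_of_counts (r := m - 1) h
    (by rw [handleCount_zero]; omega) (by rw [handleCount_one]) fun k hk => handleCount_of_two_le _ _ hk

end Literature.Topology.FourManifolds
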